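import Literature.Computability.AlgebraicComplexity.BorderRankMatMulThreeBorelData
import Literature.Computability.AlgebraicComplexity.BorderRankMatMulThreeBlocks
import HarnessLib

/-!
# Borel-fixed `(110)`-candidates of `⟨3,3,3⟩`, IV: the Borel-fixed candidate is admissible

Topic `Literature/Computability/AlgebraicComplexity`. Bridge between the Borel-fixed candidate
triple of `⟨3,3,3⟩` (`MatMul3.exists_borelFixed_triple`, `BorderRankMatMulThreeBorelData.lean`:
graded for the weights `eA, eB`, fixed by the nine root moves `Pm ⊗ Qm`, a candidate) and the
combinatorial notion `MatMul3.IsAdmissible` of `BorderRankMatMulThreeBlocks.lean`. PROVED here, for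
the `(110)` pair space `K^{(i,k)} ⊗ K^{(i',j)}` over a field of characteristic `0`:

* the weights `eA a + eB b` separate the root coordinates from everything and the block diagonals
  from each other (`MatMul3.wt_root_inj`, `MatMul3.wt_diag_iff`, kernel-checked), so a graded
  subspace contains the root-coordinate and block-diagonal components of its elements;
* the moves act as `u x = x + shiftV x` (`V`-roots), `u x = x + shiftW x` (`W`-roots) and
  `u x - u⁻¹ x = 2 · adU x` (`U`-roots) — integer coefficient identities, kernel-checked, transported
  to `K` — so a subspace fixed by the moves is stable under the shifts and `ad X_{pq}`;
* the slices of `⟨3,3,3⟩` are the identity matrices of the blocks;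

whence `MatMul3.isAdmissible_of_fixed` and, with the Borel data, `MatMul3.exists_admissible₁`:
**an approximate decomposition of `⟨3,3,3⟩` with `16` triads yields a candidate triple whose
`(110)` member is admissible.**

## References

* A. Conner, A. Harper, J. M. Landsberg, *New lower bounds for matrix multiplication and `det₃`*,
  Forum Math. Pi 11 (2023) e17, arXiv:1911.07981 — §2.5, §6. [ConnerHarperLandsberg2023]
-/

noncomputable section

open Polynomial Matrix
open scoped Polynomial BigOperators Kronecker

namespace Literature.Computability.AlgebraicComplexity

namespace BorderApolarity

namespace MatMul3

open TensorApolarity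

universe u

/-! ## Integer coefficient identities for the moves (kernel-checked) -/

/-- Entries of the Kronecker move `PZ ⊗ QZ` on the `(110)` pair space. [folklore] -/
def KZ (g ρ : Fin 3) (c c' : I9 × I9) : ℤ := PZ g ρ c.1 c'.1 * QZ g ρ c.2 c'.2

/-- Entries of the inverse move `PZ' ⊗ QZ'`. [folklore] -/
def KZ' (g ρ : Fin 3) (c c' : I9 × I9) : ℤ := PZ' g ρ c.1 c'.1 * QZ' g ρ c.2 c'.2

/-- Integer matrix of `adU p q` (`BorderRankMatMulThreeBlocks.lean`). [folklore] -/
def adUZ (p q : Fin 3) (c c' : I9 × I9) : ℤ :=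
  (if c.1.1 = p ∧ c' = ((q, c.1.2), c.2) then 1 else 0) -
    (if c.2.1 = q ∧ c' = (c.1, (p, c.2.2)) then 1 else 0)

/-- Integer matrix of `shiftV p q`. [folklore] -/
def shiftVZ (p q : Fin 3) (c c' : I9 × I9) : ℤ := if c.2.2 = p ∧ c' = (c.1, (c.2.1, q)) then 1 else 0

/-- Integer matrix of `shiftW p q`. [folklore] -/
def shiftWZ (p q : Fin 3) (c c' : I9 × I9) : ℤ := if c.1.2 = p ∧ c' = ((c.1.1, q), c.2) then 1 else 0

/-- `U`-moves: `u - u⁻¹ = 2 ad X_{pq}` entrywise. [cite: ConnerHarperLandsberg2023, §2.5] -/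
theorem KZ_U : ∀ (ρ : Fin 3) (c c' : I9 × I9),
    KZ 0 ρ c c' - KZ' 0 ρ c c' = 2 * adUZ (rootPQ ρ).1 (rootPQ ρ).2 c c' := by
  decide +kernel

/-- `V`-moves: `u - 1 = shiftV` entrywise. [cite: ConnerHarperLandsberg2023, §2.5] -/
theorem KZ_V : ∀ (ρ : Fin 3) (c c' : I9 × I9),
    KZ 1 ρ c c' - (if c = c' then 1 else 0) = shiftVZ (rootPQ ρ).1 (rootPQ ρ).2 c c' := by
  decide +kernel

/-- `W`-moves: `u - 1 = shiftW` entrywise. [cite: ConnerHarperLandsberg2023, §2.5] -/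
theorem KZ_W : ∀ (ρ : Fin 3) (c c' : I9 × I9),
    KZ 2 ρ c c' - (if c = c' then 1 else 0) = shiftWZ (rootPQ ρ).1 (rootPQ ρ).2 c c' := by
  decide +kernel

/-- The positive roots are increasing pairs. [folklore] -/
theorem rootPQ_lt : ∀ ρ : Fin 3, (rootPQ ρ).1 < (rootPQ ρ).2 := by decide

/-- Every increasing pair is a positive root. [folklore] -/
theorem exists_rootPQ : ∀ p q : Fin 3, p < q → ∃ ρ : Fin 3, rootPQ ρ = (p, q) := by decide

/-! ## Weights separate the coordinate classes (kernel-checked) -/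

/-- A root coordinate is alone in its weight. [cite: ConnerHarperLandsberg2023, §2.5] -/
theorem wt_root_inj : ∀ c c' : I9 × I9, c.1.1 ≠ c.2.1 → wt₁ eA eB c' = wt₁ eA eB c → c' = c := by
  decide +kernel

/-- The coordinates of the weight of a block diagonal are exactly that block diagonal.
[cite: ConnerHarperLandsberg2023, §2.5] -/
theorem wt_diag_iff : ∀ (c : I9 × I9) (j k : Fin 3),
    wt₁ eA eB c = wt₁ eA eB (blk j k 0 0) ↔ (c.1.2 = k ∧ c.2.2 = j ∧ c.1.1 = c.2.1) := by
  decide +kernel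

/-! ## Over a field -/

section Field

variable (K : Type u) [Field K]

/-- The Kronecker move in coordinates: `(Pm ⊗ Qm) x = ∑_{c'} KZ_{c c'} x_{c'}`. [folklore] -/
theorem kron_apply (gρ : Fin 3 × Fin 3) (x : I9 × I9 → K) (c : I9 × I9) :
    ((Pm K gρ ⊗ₖ Qm K gρ) *ᵥ x) c = ∑ c' : I9 × I9, (KZ gρ.1 gρ.2 c c' : K) * x c' := by
  rw [kronecker_mulVec_apply]
  symm
  rw [Fintype.sum_prod_type]
  refine Finset.sum_congr rfl fun a' _ => Finset.sum_congr rfl fun b' _ => ?_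
  simp only [Pm, Qm, KZ, Matrix.map_apply, eq_intCast, Int.cast_mul]

/-- The inverse move in coordinates. [folklore] -/
theorem kron'_apply (gρ : Fin 3 × Fin 3) (x : I9 × I9 → K) (c : I9 × I9) :
    ((Pm' K gρ ⊗ₖ Qm' K gρ) *ᵥ x) c = ∑ c' : I9 × I9, (KZ' gρ.1 gρ.2 c c' : K) * x c' := by
  rw [kronecker_mulVec_apply]
  symm
  rw [Fintype.sum_prod_type]
  refine Finset.sum_congr rfl fun a' _ => Finset.sum_congr rfl fun b' _ => ?_
  simp only [Pm', Qm', KZ', Matrix.map_apply, eq_intCast, Int.cast_mul]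

/-- A sum against an indicator `[P ∧ c' = t]` picks out `x t`. [folklore] -/
theorem sum_ite_and_eq (P : Prop) [Decidable P] (t : I9 × I9) (x : I9 × I9 → K) :
    ∑ c' : I9 × I9, ((if P ∧ c' = t then (1 : ℤ) else 0 : ℤ) : K) * x c' = if P then x t else 0 := by
  by_cases hP : P
  · simp only [hP, true_and, if_true]
    rw [Finset.sum_eq_single t]
    · simp
    · intro c' _ hne; simp [hne]
    · intro h; exact absurd (Finset.mem_univ _) h
  · simp [hP]

/-- `adU` in coordinates. [folklore] -/
theorem adU_apply_sum (p q : Fin 3) (x : I9 × I9 → K) (c : I9 × I9) :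
    adU p q x c = ∑ c' : I9 × I9, (adUZ p q c c' : K) * x c' := by
  simp only [adUZ, Int.cast_sub, sub_mul, Finset.sum_sub_distrib, sum_ite_and_eq]
  rfl

/-- `shiftV` in coordinates. [folklore] -/
theorem shiftV_apply_sum (p q : Fin 3) (x : I9 × I9 → K) (c : I9 × I9) :
    shiftV p q x c = ∑ c' : I9 × I9, (shiftVZ p q c c' : K) * x c' := by
  simp only [shiftVZ, sum_ite_and_eq]
  rfl

/-- `shiftW` in coordinates. [folklore] -/
theorem shiftW_apply_sum (p q : Fin 3) (x : I9 × I9 → K) (c : I9 × I9) :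
    shiftW p q x c = ∑ c' : I9 × I9, (shiftWZ p q c c' : K) * x c' := by
  simp only [shiftWZ, sum_ite_and_eq]
  rfl

/-- **`U`-moves act as `u x - u⁻¹ x = 2 · ad X_{pq} x`.** [cite: ConnerHarperLandsberg2023, §2.5] -/
theorem kron_U_sub (ρ : Fin 3) (x : I9 × I9 → K) :
    (Pm K (0, ρ) ⊗ₖ Qm K (0, ρ)) *ᵥ x - (Pm' K (0, ρ) ⊗ₖ Qm' K (0, ρ)) *ᵥ x =
      (2 : K) • adU (rootPQ ρ).1 (rootPQ ρ).2 x := by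
  funext c
  rw [Pi.sub_apply, Pi.smul_apply, kron_apply, kron'_apply, adU_apply_sum, smul_eq_mul,
    Finset.mul_sum, ← Finset.sum_sub_distrib]
  refine Finset.sum_congr rfl fun c' _ => ?_
  have h := congrArg (Int.cast : ℤ → K) (KZ_U ρ c c')
  simp only [Int.cast_sub, Int.cast_mul, Int.cast_ofNat] at h
  rw [← sub_mul, h]
  ring

/-- **`V`-moves act as `u x = x + shiftV x`.** [cite: ConnerHarperLandsberg2023, §2.5] -/
theorem kron_V_sub (ρ : Fin 3) (x : I9 × I9 → K) :
    (Pm K (1, ρ) ⊗ₖ Qm K (1, ρ)) *ᵥ x - x = shiftV (rootPQ ρ).1 (rootPQ ρ).2 x := by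
  funext c
  rw [Pi.sub_apply, kron_apply, shiftV_apply_sum]
  have hx : x c = ∑ c' : I9 × I9, ((if c = c' then (1 : ℤ) else 0 : ℤ) : K) * x c' := by
    rw [Finset.sum_eq_single c]
    · simp
    · intro c' _ hne; simp [Ne.symm hne]
    · intro h; exact absurd (Finset.mem_univ _) h
  rw [hx, ← Finset.sum_sub_distrib]
  refine Finset.sum_congr rfl fun c' _ => ?_
  have h := congrArg (Int.cast : ℤ → K) (KZ_V ρ c c')
  simp only [Int.cast_sub] at h
  rw [← sub_mul, h]

/-- **`W`-moves act as `u x = x + shiftW x`.** [cite: ConnerHarperLandsberg2023, §2.5] -/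
theorem kron_W_sub (ρ : Fin 3) (x : I9 × I9 → K) :
    (Pm K (2, ρ) ⊗ₖ Qm K (2, ρ)) *ᵥ x - x = shiftW (rootPQ ρ).1 (rootPQ ρ).2 x := by
  funext c
  rw [Pi.sub_apply, kron_apply, shiftW_apply_sum]
  have hx : x c = ∑ c' : I9 × I9, ((if c = c' then (1 : ℤ) else 0 : ℤ) : K) * x c' := by
    rw [Finset.sum_eq_single c]
    · simp
    · intro c' _ hne; simp [Ne.symm hne]
    · intro h; exact absurd (Finset.mem_univ _) h
  rw [hx, ← Finset.sum_sub_distrib]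
  refine Finset.sum_congr rfl fun c' _ => ?_
  have h := congrArg (Int.cast : ℤ → K) (KZ_W ρ c c')
  simp only [Int.cast_sub] at h
  rw [← sub_mul, h]

/-! ## Admissibility of a graded subspace fixed by the moves -/

variable {K}

/-- A subspace fixed by an invertible move is fixed by its inverse. [folklore] -/
theorem inv_mem_of_map_eq {P P' Q Q' : Matrix I9 I9 K} (hP : P' * P = 1) (hQ : Q' * Q = 1)
    {E : Submodule K (I9 × I9 → K)} (hE : E.map (P ⊗ₖ Q).mulVecLin = E) {x : I9 × I9 → K}
    (hx : x ∈ E) : (P' ⊗ₖ Q') *ᵥ x ∈ E := by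
  have hx' : x ∈ E.map (P ⊗ₖ Q).mulVecLin := by rw [hE]; exact hx
  obtain ⟨y, hy, rfl⟩ := hx'
  rw [mulVecLin_apply, mulVec_mulVec, kronecker_mul_kronecker_eq_one hP hQ, one_mulVec]
  exact hy

/-- **A graded subspace of the `(110)` pair space of `⟨3,3,3⟩` which contains the slices, is fixed
by the nine root moves and has dimension `≤ 16` is admissible** (characteristic `0`).
[cite: ConnerHarperLandsberg2023, §2.5 and §6] -/
theorem isAdmissible_of_fixed [CharZero K] {E : Submodule K (I9 × I9 → K)}
    (hgr : WtInit.IsGraded (degIK eA eB) E)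
    (hsl : ∀ c : I9, (fun ab : I9 × I9 => matMulTensor K 3 3 3 ab.1 ab.2 c) ∈ E)
    (hfix : ∀ gρ : Fin 3 × Fin 3, E.map (Pm K gρ ⊗ₖ Qm K gρ).mulVecLin = E)
    (hdim : Module.finrank K E ≤ 16) : IsAdmissible E := by
  have hmem : ∀ (gρ : Fin 3 × Fin 3) {x}, x ∈ E → (Pm K gρ ⊗ₖ Qm K gρ) *ᵥ x ∈ E := by
    intro gρ x hx
    have : (Pm K gρ ⊗ₖ Qm K gρ).mulVecLin x ∈ E.map (Pm K gρ ⊗ₖ Qm K gρ).mulVecLin :=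
      Submodule.mem_map_of_mem hx
    rwa [hfix] at this
  refine ⟨fun j k i i' hii' x hx => ?_, fun j k x hx => ?_, fun j k => ?_, fun p q hpq x hx => ?_,
    fun p q hpq x hx => ?_, fun p q hpq x hx => ?_, hdim⟩
  · -- root components: the root coordinate is alone in its weight
    have h := hgr (degIK eA eB (blk j k i i')) x hx
    convert h using 1
    funext c'
    rw [projDeg_apply, Pi.single_apply]
    by_cases hc : c' = blk j k i i'
    · rw [if_pos hc, if_pos (by rw [hc]), hc]
    · rw [if_neg hc, if_neg]
      intro heq
      apply hc
      refine wt_root_inj (blk j k i i') c' hii' ?_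
      simp only [degIK] at heq
      exact_mod_cast heq
  · -- block-diagonal components
    have h := hgr (degIK eA eB (blk j k 0 0)) x hx
    convert h using 1
    funext c'
    simp only [diagProj, LinearMap.coe_mk, AddHom.coe_mk, projDeg_apply]
    have hiff := wt_diag_iff c' j k
    have hiff' : degIK eA eB c' = degIK eA eB (blk j k 0 0) ↔
        (c'.1.2 = k ∧ c'.2.2 = j ∧ c'.1.1 = c'.2.1) := by
      rw [← hiff]; simp only [degIK]; exact_mod_cast Iff.rfl
    by_cases hc : c'.1.2 = k ∧ c'.2.2 = j ∧ c'.1.1 = c'.2.1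
    · rw [if_pos hc, if_pos (hiff'.2 hc)]
    · rw [if_neg hc, if_neg (fun h' => hc (hiff'.1 h'))]
  · -- the identity matrix of block `(j,k)` is the slice `t(·,·,(j,k))`
    convert hsl (j, k) using 1
    funext c
    rw [← blk_eta c, diagVec_blk]
    simp only [matMulTensor, blk]
    grind
  · -- `ad X_{pq} x = (u x - u⁻¹ x) / 2`
    obtain ⟨ρ, hρ⟩ := exists_rootPQ p q hpq
    have h1 := hmem (0, ρ) hx
    have h2 := inv_mem_of_map_eq (Pm'_mul_Pm K (0, ρ)) (Qm'_mul_Qm K (0, ρ)) (hfix (0, ρ)) hx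
    have h3 := Submodule.sub_mem _ h1 h2
    rw [kron_U_sub, hρ] at h3
    have : adU p q x = (2 : K)⁻¹ • ((2 : K) • adU p q x) := by
      rw [smul_smul, inv_mul_cancel₀ (two_ne_zero), one_smul]
    rw [this]
    exact Submodule.smul_mem _ _ h3
  · obtain ⟨ρ, hρ⟩ := exists_rootPQ p q hpq
    have h := Submodule.sub_mem _ (hmem (1, ρ) hx) hx
    rw [kron_V_sub, hρ] at h
    exact h
  · obtain ⟨ρ, hρ⟩ := exists_rootPQ p q hpq
    have h := Submodule.sub_mem _ (hmem (2, ρ) hx) hx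
    rw [kron_W_sub, hρ] at h
    exact h

/-- **The `(110)` member of the Borel-fixed candidate triple of `⟨3,3,3⟩` is admissible.**
[cite: ConnerHarperLandsberg2023, §6] -/
theorem exists_admissible₁ (K : Type u) [Field K] [CharZero K] {h : ℕ} {u v w : Fin 16 → I9 → K[X]}
    (hd : IsApproxDecomposition h (matMulTensor K 3 3 3) u v w) :
    ∃ (E₁ E₂ E₃ : Submodule K (I9 × I9 → K)), IsCandidateTriple 16 (matMulTensor K 3 3 3) E₁ E₂ E₃ ∧
      IsAdmissible E₁ ∧ WtInit.IsGraded (degIK eB eC) E₂ ∧ WtInit.IsGraded (degIK eA eC) E₃ ∧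
      ∀ gρ : Fin 3 × Fin 3, E₂.map (Qm K gρ ⊗ₖ Rm K gρ).mulVecLin = E₂ ∧
        E₃.map (Pm K gρ ⊗ₖ Rm K gρ).mulVecLin = E₃ := by
  obtain ⟨E₁, E₂, E₃, hc, hg₁, hg₂, hg₃, hfix⟩ := exists_borelFixed_triple K hd
  exact ⟨E₁, E₂, E₃, hc, isAdmissible_of_fixed hg₁ hc.slice₁ (fun gρ => (hfix gρ).1) hc.finrank₁, hg₂, hg₃,
    fun gρ => ⟨(hfix gρ).2.1, (hfix gρ).2.2⟩⟩

end Field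

end MatMul3

end BorderApolarity

end Literature.Computability.AlgebraicComplexity

end
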